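import Literature.NumberTheory.GaloisRepresentations.HeckeCharacterExtensionQuadraticWeilProofs
import HarnessLib

/-!
# Extension of idele class characters along a CM quadratic extension: roots of unity, the
# archimedean character `Φ_m`, and the key identity for triples with `k ∈ F₀`

Topic `NumberTheory/GaloisRepresentations`; namespace
`Literature.NumberTheory.GaloisRepresentations.HeckeCharacter.CMQuadraticExtension`.  Proof file
(theorems only), second of three (`…WeilProofs`, `…ArchProofs`, `…CMProofs`) on the CM / finite-order
special case of `HewittRoss_heckeCharacter_extension_quadratic` by Weil's method:

* §4 `pow_torsionOrder_eq_one_of_triple` — in the CM situation, if `a_K · y = (k)` with `a ∈ 𝕀_{F₀}`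
  and `y ∈ 𝕌_K`, then `k / c(k)` is a root of unity (Kronecker, `NumberField.Units.mem_torsion`).
* §5 `archChar_baseChange_eq` — the archimedean character `Φ_m(z) = ∏_w (ι_w z_w/|ι_w z_w|)^{m_w}`
  restricts along `(F₀ ⊗ ℝ)ˣ → (K ⊗ ℝ)ˣ` to the finite-order `χ₀` when the parities `m_w mod 2` are the
  signs of `χ₀` at `w|_{F₀}` (Neukirch VII (6.9) for the totally positive part).
* §6 `key_of_mem_range` — `χ₀(a) Φ(y_∞) = 1` for `a_K y = (k₀)_K`, `k₀ ∈ F₀ˣ`, `y ∈ V`.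

## References

* A. Weil, *On a certain type of characters of the idèle-class group*, Tokyo–Nikko 1955 (1956), §1. [Weil1956]
* J. Neukirch, *Algebraic Number Theory*, Grundlehren 322 (1999), Ch. VII §6 (6.9). [NeukirchANT1999]
-/

noncomputable section

open scoped NumberField Topology
open NumberField IsDedekindDomain Filter
open Literature.NumberTheory.Automorphic

namespace Literature.NumberTheory.GaloisRepresentations

namespace HeckeCharacter

variable {F₀ K : Type} [Field F₀] [NumberField F₀] [Field K] [NumberField K] [Algebra F₀ K]

/-! ### §4. Principal ideles in `BC(𝕀_{F₀}) · 𝕌_K` are `F₀ˣ`-multiples of roots of unity -/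

namespace CMQuadraticExtension

omit [NumberField F₀] in
/-- `𝕌_K` is stable under `Aut(K/F₀)`. [folklore] -/
theorem smul_mem_unitIdeles (σ : K ≃ₐ[F₀] K) {y : ideleGroup K} (hy : y ∈ unitIdeles K) :
    σ • y ∈ unitIdeles K := by
  rw [mem_unitIdeles_iff_mem_and_inv_mem] at hy ⊢
  refine ⟨?_, ?_⟩
  · rw [AdeleRing.coe_smul_units, AdeleRing.smul_snd]
    exact (FiniteAdeleRing.forall_smul_apply_mem_iff K σ _).mpr hy.1
  · rw [← smul_inv', AdeleRing.coe_smul_units, AdeleRing.smul_snd]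
    exact (FiniteAdeleRing.forall_smul_apply_mem_iff K σ _).mpr hy.2

omit [NumberField F₀] in
/-- `σ • (k) = (σ k)` for principal ideles. [folklore] -/
theorem smul_principalIdele (σ : K ≃ₐ[F₀] K) (k : Kˣ) :
    σ • principalIdele K k = principalIdele K (Units.map (σ : K →+* K).toMonoidHom k) := by
  apply Units.ext
  rw [AdeleRing.coe_smul_units]
  change σ • algebraMap K (AdeleRing (𝓞 K) K) (k : K) = algebraMap K (AdeleRing (𝓞 K) K) (σ (k : K))
  rw [AdeleRing.smul_algebraMap]

/-- The principal idele of an element of `F₀` is the base change of its principal idele. [folklore] -/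
theorem principalIdele_algebraMap (k₀ : F₀ˣ) :
    principalIdele K (Units.map (algebraMap F₀ K : F₀ →* K) k₀) =
      AdeleRing.ideleBaseChange F₀ K (principalIdele F₀ k₀) := by
  apply Units.ext
  rw [AdeleRing.coe_ideleBaseChange]
  change algebraMap K (AdeleRing (𝓞 K) K) (algebraMap F₀ K (k₀ : F₀)) =
    AdeleRing.baseChange F₀ K (algebraMap F₀ (AdeleRing (𝓞 F₀) F₀) (k₀ : F₀))
  rw [AdeleRing.baseChange_algebraMap]

section Torsion

variable (c : K ≃ₐ[F₀] K) (h2 : Module.finrank F₀ K = 2) (hc : c ≠ 1)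
  (hTR : IsTotallyReal F₀) (hTC : IsTotallyComplex K)

include h2 hc hTR hTC in
/-- **Roots of unity.**  In the CM situation, if `a_K · y = (k)` with `a ∈ 𝕀_{F₀}` and `y ∈ 𝕌_K`, then
`k / c(k)` is a root of unity: a global unit (`(k/ck) = y / c y ∈ 𝕌_K`) with all archimedean absolute
values `1` (`|c k|_w = |k|_w`), hence torsion (Kronecker, `NumberField.Units.mem_torsion`). [folklore] -/
theorem pow_torsionOrder_eq_one_of_triple {a : ideleGroup F₀} {y : ideleGroup K} {k : Kˣ}
    (hy : y ∈ unitIdeles K) (h : AdeleRing.ideleBaseChange F₀ K a * y = principalIdele K k) :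
    (k * (Units.map (c : K →+* K).toMonoidHom k)⁻¹) ^ Units.torsionOrder K = 1 := by
  set k' : Kˣ := Units.map (c : K →+* K).toMonoidHom k with hk'
  -- `(k / c k) = y / c y` is a unit idele
  have hcy : AdeleRing.ideleBaseChange F₀ K a * (c • y) = principalIdele K k' := by
    rw [hk', ← smul_principalIdele, ← h, smul_mul', AdeleRing.smul_ideleBaseChange]
  have hquot : principalIdele K (k * k'⁻¹) = y * (c • y)⁻¹ := by
    rw [map_mul, map_inv, ← h, ← hcy, ← div_eq_mul_inv, mul_div_mul_left_eq_div, div_eq_mul_inv]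
  have hunit : principalIdele K (k * k'⁻¹) ∈ unitIdeles K := by
    rw [hquot]
    exact (unitIdeles K).mul_mem hy ((unitIdeles K).inv_mem (smul_mem_unitIdeles c hy))
  obtain ⟨ε, hε⟩ := exists_units_eq_of_mem_unitIdeles hunit
  -- all archimedean absolute values of `k / c k` are `1`
  have htors : ε ∈ Units.torsion K := by
    rw [Units.mem_torsion]
    intro w
    change w (((ε : 𝓞 K) : K)) = 1
    rw [show ((ε : 𝓞 K) : K) = algebraMap (𝓞 K) K (ε : 𝓞 K) from rfl, hε, Units.val_mul,
      Units.val_inv_eq_inv_val, map_mul, map_inv₀, hk']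
    change w (k : K) * (w (c (k : K)))⁻¹ = 1
    rw [infinitePlace_apply_conj c h2 hc hTR hTC, mul_inv_cancel₀]
    exact (map_ne_zero w).mpr k.ne_zero
  -- hence `(k / c k)^{#μ(K)} = 1`
  have hpow : ε ^ Units.torsionOrder K = 1 := by
    have : ε ∈ rootsOfUnity (Units.torsionOrder K) (𝓞 K) := by
      rw [Units.rootsOfUnity_eq_torsion]; exact htors
    exact (mem_rootsOfUnity _ _).mp this
  apply Units.ext
  have h1 : ((k * k'⁻¹ : Kˣ) : K) = algebraMap (𝓞 K) K (ε : 𝓞 K) := hε.symm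
  rw [Units.val_pow_eq_pow_val, h1, ← map_pow, Units.val_one, ← Units.val_pow_eq_pow_val, hpow]
  simp

end Torsion

/-! ### §5. The archimedean character `Φ_m` and its restriction to `(F₀ ⊗ ℝ)ˣ` -/

/-- `(t/|t|)^m |t|^{0·i} = 1` for a positive real `t`. [folklore] -/
theorem archUnitaryValue_ofReal_of_pos {t : ℝ} (ht : 0 < t) (m : ℤ) :
    archUnitaryValue m 0 (t : ℂ) = 1 := by
  unfold archUnitaryValue
  have h1 : (‖(t : ℂ)‖ : ℂ) = (t : ℂ) := by rw [Complex.norm_real, Real.norm_of_nonneg ht.le]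
  rw [h1, div_self (by exact_mod_cast ht.ne'), one_zpow, one_mul, Complex.ofReal_zero, zero_mul,
    Complex.cpow_zero]

/-- `(t/|t|)^m |t|^{0·i} = (-1)^m` for a negative real `t`. [folklore] -/
theorem archUnitaryValue_ofReal_of_neg {t : ℝ} (ht : t < 0) (m : ℤ) :
    archUnitaryValue m 0 (t : ℂ) = (-1) ^ m := by
  unfold archUnitaryValue
  have h1 : (‖(t : ℂ)‖ : ℂ) = -(t : ℂ) := by
    rw [Complex.norm_real, Real.norm_eq_abs, abs_of_neg ht, Complex.ofReal_neg]
  have ht0 : (t : ℂ) ≠ 0 := by exact_mod_cast ht.ne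
  rw [h1, div_neg, div_self ht0, Complex.ofReal_zero, zero_mul, Complex.cpow_zero, mul_one]

omit [NumberField F₀] [NumberField K] in
/-- At an infinite place `w` of `K` above a REAL place `v` of `F₀`, Mathlib's complex embedding of
`K_w` restricts along `F₀,v → K_w` to the (real) embedding of `F₀,v`. [folklore] -/
theorem extensionEmbedding_infiniteCompletionOfComap (w : InfinitePlace K)
    (hv : (w.comap (algebraMap F₀ K)).IsReal) (t : (w.comap (algebraMap F₀ K)).Completion) :
    InfinitePlace.Completion.extensionEmbedding w (infiniteCompletionOfComap F₀ K w t) =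
      ((InfinitePlace.Completion.extensionEmbeddingOfIsReal hv t : ℝ) : ℂ) := by
  rw [InfinitePlace.Completion.extensionEmbeddingOfIsReal_apply]
  haveI : w.1.LiesOver (w.comap (algebraMap F₀ K)).1 := ⟨rfl⟩
  -- both sides are continuous in `t` and agree on `F₀`
  refine congrFun (InfinitePlace.Completion.ext_of_coe (w.comap (algebraMap F₀ K))
    ((InfinitePlace.Completion.isometry_extensionEmbedding w).continuous.comp
      (continuous_infiniteCompletionOfComap F₀ K w))
    (InfinitePlace.Completion.isometry_extensionEmbedding (w.comap (algebraMap F₀ K))).continuous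
    fun x => ?_) t
  simp only [Function.comp_apply]
  rw [infiniteCompletionOfComap_coe, InfinitePlace.Completion.extensionEmbedding_coe,
    InfinitePlace.Completion.extensionEmbedding_coe]
  change w.embedding (algebraMap F₀ K x) = (w.comap (algebraMap F₀ K)).embedding x
  haveI := InfinitePlace.LiesOver.embedding_liesOver_of_isReal w hv
  exact ComplexEmbedding.LiesOver.over_apply _ _

section Arch

variable (χ₀ : HeckeCharacter F₀)

/-- **A finite-order Hecke character kills the totally positive infinite ideles** (they are `n`-th
powers, `n` the order).  Ref: Neukirch, *Algebraic Number Theory*, Ch. VII §6, (6.9).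
[cite: NeukirchANT1999, Ch. VII §6 Prop. (6.9)] -/
theorem map_infiniteIdeles_eq_one_of_forall_pos (hχ : χ₀.IsFiniteOrder)
    (hreal : ∀ v : InfinitePlace F₀, v.IsReal) (x : (InfiniteAdeleRing F₀)ˣ)
    (hpos : ∀ v : InfinitePlace F₀,
      0 < InfinitePlace.Completion.extensionEmbeddingOfIsReal (hreal v) ((x : InfiniteAdeleRing F₀) v)) :
    χ₀ (infiniteIdeles F₀ x) = 1 := by
  classical
  set n := orderOf χ₀ with hn
  have hn0 : 0 < n := hχ.orderOf_pos
  -- an `n`-th root at each (real) place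
  have hw : ∀ v : InfinitePlace F₀, ∃ y : v.Completion, y ^ n = (x : InfiniteAdeleRing F₀) v := by
    intro v
    let e := InfinitePlace.Completion.ringEquivRealOfIsReal (hreal v)
    have hr : 0 < e ((x : InfiniteAdeleRing F₀) v) := by
      rw [InfinitePlace.Completion.ringEquivRealOfIsReal_apply]; exact hpos v
    refine ⟨e.symm ((e ((x : InfiniteAdeleRing F₀) v)) ^ ((n : ℝ)⁻¹)), e.injective ?_⟩
    rw [map_pow, RingEquiv.apply_symm_apply, Real.rpow_inv_natCast_pow hr.le hn0.ne']
  choose y hy using hw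
  have hx0 : ∀ v, (x : InfiniteAdeleRing F₀) v ≠ 0 := fun v h0 => by
    have h1 : (x : InfiniteAdeleRing F₀) v * ((x⁻¹ : (InfiniteAdeleRing F₀)ˣ) : InfiniteAdeleRing F₀) v =
        (1 : InfiniteAdeleRing F₀) v := congrFun x.mul_inv v
    rw [h0, zero_mul] at h1
    exact zero_ne_one h1
  have hy0 : ∀ v, y v ≠ 0 := fun v h0 => by
    have := hy v
    rw [h0, zero_pow hn0.ne'] at this
    exact hx0 v this.symm
  have hyinv : ∀ v, y v * (y v)⁻¹ = 1 := fun v => mul_inv_cancel₀ (hy0 v)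
  obtain ⟨z, hz⟩ : ∃ z : (InfiniteAdeleRing F₀)ˣ, z ^ n = x :=
    ⟨⟨fun v => y v, fun v => (y v)⁻¹, funext fun v => hyinv v,
      funext fun v => by rw [mul_comm]; exact hyinv v⟩, Units.ext (funext fun v => by
        rw [Units.val_pow_eq_pow_val]; exact hy v)⟩
  rw [← hz, map_pow, map_pow, ← pow_apply, hn, pow_orderOf_eq_one, one_apply]

variable (c : K ≃ₐ[F₀] K) (h2 : Module.finrank F₀ K = 2) (hc : c ≠ 1)
  (hTR : IsTotallyReal F₀) (hTC : IsTotallyComplex K)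

include h2 hc hTR hTC in
/-- **Archimedean compatibility `Φ_m ∘ BC = χ₀` on `(F₀ ⊗ ℝ)ˣ`.**  Let `χ₀` have finite order with signs
`χ₀(-1_v) = (-1)^{b_v}` at the real places `v`.  If `m_w ≡ b_{w|F₀} mod 2` for every infinite place `w`
of `K`, then `Φ_m(z) = ∏_w (ι_w z_w/|ι_w z_w|)^{m_w}` restricts to `χ₀` on `(F₀ ⊗ ℝ)ˣ` (both kill the
totally positive elements and agree on the sign ideles; in the CM situation `w ↦ w|_{F₀}` is bijective).
[folklore] -/
theorem archChar_baseChange_eq (hχ : χ₀.IsFiniteOrder) (b : InfinitePlace F₀ → ℕ)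
    (hb : ∀ (v : InfinitePlace F₀) (e : (InfiniteAdeleRing F₀)ˣ), (e : InfiniteAdeleRing F₀) v = -1 →
      (∀ v', v' ≠ v → (e : InfiniteAdeleRing F₀) v' = 1) → (χ₀ (infiniteIdeles F₀ e) : ℂ) = (-1) ^ b v)
    (m : InfinitePlace K → ℤ) (hm : ∀ w, ∃ j : ℤ, m w = b (w.comap (algebraMap F₀ K)) + 2 * j)
    (Φ : (InfiniteAdeleRing K)ˣ →ₜ* ℂˣ)
    (hΦ : ∀ z : (InfiniteAdeleRing K)ˣ, (Φ z : ℂ) = ∏ w : InfinitePlace K,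
      archUnitaryValue (m w) 0 (InfinitePlace.Completion.extensionEmbedding w ((z : InfiniteAdeleRing K) w)))
    (x : (InfiniteAdeleRing F₀)ˣ) :
    (Φ (HeckeCharacter.infPart K (AdeleRing.ideleBaseChange F₀ K (infiniteIdeles F₀ x))) : ℂ) =
      χ₀ (infiniteIdeles F₀ x) := by
  classical
  have hreal : ∀ v : InfinitePlace F₀, v.IsReal := fun v => hTR.isReal v
  -- notation: the place `vK w` of `F₀` below `w`, the real coordinate maps `ι v`
  set vK : InfinitePlace K → InfinitePlace F₀ := fun w => w.comap (algebraMap F₀ K) with hvK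
  set ι : ∀ v : InfinitePlace F₀, v.Completion →+* ℝ :=
    fun v => InfinitePlace.Completion.extensionEmbeddingOfIsReal (hreal v) with hιdef
  -- evaluation at a place, as a monoid hom (to evaluate products componentwise)
  let ev : ∀ v : InfinitePlace F₀, InfiniteAdeleRing F₀ →* v.Completion :=
    fun v => { toFun := fun y => y v, map_one' := rfl, map_mul' := fun _ _ => rfl }
  have hev : ∀ v (y : InfiniteAdeleRing F₀), ev v y = y v := fun v y => rfl
  -- the value of `Φ ∘ BC` on an infinite idele of `F₀`
  have hΦBC : ∀ z : (InfiniteAdeleRing F₀)ˣ,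
      (Φ (HeckeCharacter.infPart K (AdeleRing.ideleBaseChange F₀ K (infiniteIdeles F₀ z))) : ℂ) =
        ∏ w : InfinitePlace K, archUnitaryValue (m w) 0
          ((ι (vK w) ((z : InfiniteAdeleRing F₀) (vK w)) : ℝ) : ℂ) := by
    intro z
    rw [hΦ]
    refine Finset.prod_congr rfl fun w _ => ?_
    congr 1
    exact extensionEmbedding_infiniteCompletionOfComap w (hreal _) _
  -- the sign ideles `-1_v`
  let negAt : InfinitePlace F₀ → (InfiniteAdeleRing F₀)ˣ := fun v =>
    ⟨fun v' => if v' = v then -1 else 1, fun v' => if v' = v then -1 else 1,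
      funext fun v' => by
        change (if v' = v then (-1 : v'.Completion) else 1) * (if v' = v then (-1 : v'.Completion) else 1) = 1
        split_ifs <;> simp,
      funext fun v' => by
        change (if v' = v then (-1 : v'.Completion) else 1) * (if v' = v then (-1 : v'.Completion) else 1) = 1
        split_ifs <;> simp⟩
  have hnegAt_apply : ∀ v v', ((negAt v : (InfiniteAdeleRing F₀)ˣ) : InfiniteAdeleRing F₀) v' =
      if v' = v then -1 else 1 := fun v v' => rfl
  have hχneg : ∀ v, (χ₀ (infiniteIdeles F₀ (negAt v)) : ℂ) = (-1) ^ b v := fun v =>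
    hb v (negAt v) (by rw [hnegAt_apply, if_pos rfl]) (fun v' hv' => by rw [hnegAt_apply, if_neg hv'])
  -- the set of places where `x` is negative, and the sign idele `s` of `x`
  set NEG : Finset (InfinitePlace F₀) := Finset.univ.filter fun v => ¬ 0 < ι v ((x : InfiniteAdeleRing F₀) v)
    with hNEG
  set s : (InfiniteAdeleRing F₀)ˣ := ∏ v ∈ NEG, negAt v with hsdef
  have hs_apply : ∀ v', (s : InfiniteAdeleRing F₀) v' = if v' ∈ NEG then -1 else 1 := by
    intro v'
    have e1 : (s : InfiniteAdeleRing F₀) v' = ev v' (s : InfiniteAdeleRing F₀) := rfl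
    rw [e1, hsdef, Units.coe_prod, map_prod]
    simp_rw [hev, hnegAt_apply]
    exact Finset.prod_ite_eq NEG v' (fun _ => (-1 : v'.Completion))
  have hmemNEG : ∀ v, v ∈ NEG ↔ ¬ 0 < ι v ((x : InfiniteAdeleRing F₀) v) := fun v => by
    rw [hNEG, Finset.mem_filter]; simp
  have hs2 : s * s = 1 := by
    apply Units.ext
    funext v'
    change (s : InfiniteAdeleRing F₀) v' * (s : InfiniteAdeleRing F₀) v' = (1 : InfiniteAdeleRing F₀) v'
    rw [hs_apply]
    split_ifs <;> simp
  have hx0 : ∀ v, ι v ((x : InfiniteAdeleRing F₀) v) ≠ 0 := fun v h0 => by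
    have h1 : (x : InfiniteAdeleRing F₀) v * ((x⁻¹ : (InfiniteAdeleRing F₀)ˣ) : InfiniteAdeleRing F₀) v =
        (1 : InfiniteAdeleRing F₀) v := congrFun x.mul_inv v
    have := congrArg (ι v) h1
    rw [map_mul, h0, zero_mul] at this
    exact zero_ne_one (this.trans (map_one _))
  have hιs : ∀ v, ι v ((s : InfiniteAdeleRing F₀) v) = if v ∈ NEG then -1 else 1 := fun v => by
    rw [hs_apply]; split_ifs <;> simp
  have hpos : ∀ v, 0 < ι v (((x * s : (InfiniteAdeleRing F₀)ˣ) : InfiniteAdeleRing F₀) v) := by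
    intro v
    change 0 < ι v ((x : InfiniteAdeleRing F₀) v * (s : InfiniteAdeleRing F₀) v)
    rw [map_mul, hιs]
    split_ifs with h
    · rw [mul_neg_one, Left.neg_pos_iff]
      exact lt_of_le_of_ne (not_lt.mp ((hmemNEG v).mp h)) (hx0 v)
    · rw [mul_one]
      exact not_not.mp fun h' => h ((hmemNEG v).mpr h')
  -- both sides kill `x s`
  have hχxs : χ₀ (infiniteIdeles F₀ (x * s)) = 1 :=
    map_infiniteIdeles_eq_one_of_forall_pos χ₀ hχ hreal (x * s) hpos
  have hΦxs : (Φ (HeckeCharacter.infPart K (AdeleRing.ideleBaseChange F₀ K (infiniteIdeles F₀ (x * s)))) : ℂ)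
      = 1 := by
    rw [hΦBC]
    exact Finset.prod_eq_one fun w _ => archUnitaryValue_ofReal_of_pos (hpos _) _
  -- hence both are determined by their value on `s`
  have hx_eq : x = (x * s) * s := by rw [mul_assoc, hs2, mul_one]
  have hL : (Φ (HeckeCharacter.infPart K (AdeleRing.ideleBaseChange F₀ K (infiniteIdeles F₀ x))) : ℂ) =
      Φ (HeckeCharacter.infPart K (AdeleRing.ideleBaseChange F₀ K (infiniteIdeles F₀ s))) := by
    conv_lhs => rw [hx_eq]
    rw [map_mul, map_mul, map_mul, map_mul, Units.val_mul, hΦxs, one_mul]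
  have hR : (χ₀ (infiniteIdeles F₀ x) : ℂ) = χ₀ (infiniteIdeles F₀ s) := by
    conv_lhs => rw [hx_eq]
    rw [map_mul, map_mul, Units.val_mul, hχxs, Units.val_one, one_mul]
  rw [hL, hR]
  -- the value of `χ₀` on `s`: a product of signs
  have hχs : (χ₀ (infiniteIdeles F₀ s) : ℂ) = ∏ v ∈ NEG, (-1 : ℂ) ^ b v := by
    rw [hsdef, map_prod, map_prod, Units.coe_prod]
    exact Finset.prod_congr rfl fun v _ => hχneg v
  -- the value of `Φ ∘ BC` on `s`
  have hΦs : (Φ (HeckeCharacter.infPart K (AdeleRing.ideleBaseChange F₀ K (infiniteIdeles F₀ s))) : ℂ) =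
      ∏ w : InfinitePlace K, if vK w ∈ NEG then (-1 : ℂ) ^ b (vK w) else 1 := by
    rw [hΦBC]
    refine Finset.prod_congr rfl fun w _ => ?_
    rw [hιs]
    split_ifs with h
    · rw [archUnitaryValue_ofReal_of_neg (by norm_num) _]
      obtain ⟨j, hj⟩ := hm w
      have h22 : ((-1 : ℂ) ^ (2 : ℤ)) = 1 := by norm_num
      rw [hj, zpow_add₀ (by norm_num : (-1 : ℂ) ≠ 0), zpow_natCast, zpow_mul, h22, one_zpow, mul_one]
    · exact archUnitaryValue_ofReal_of_pos (by norm_num) _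
  -- reindex along the bijection `w ↦ w|_{F₀}`
  have hbij : Function.Bijective vK := ⟨comap_injective c h2 hc hTR hTC, InfinitePlace.comap_surjective⟩
  rw [hχs, hΦs, hbij.prod_comp (fun v => if v ∈ NEG then (-1 : ℂ) ^ b v else 1), Finset.prod_ite_mem,
    Finset.univ_inter]

end Arch

/-! ### §6. The key identity on triples `a_K · y = (k)` with `k ∈ F₀` -/

section Fixed

variable (S : Finset (HeightOneSpectrum (𝓞 K))) (E : HeightOneSpectrum (𝓞 K) → ℕ)

/-- For `K` totally complex, membership in `V = 𝕌_K ∩ W_𝔣` only depends on the finite components.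
[folklore] -/
theorem mem_nbhd_of_snd_eq (hTC : IsTotallyComplex K) {z z' : ideleGroup K}
    (h : ∀ u, (z : AdeleRing (𝓞 K) K).2 u = (z' : AdeleRing (𝓞 K) K).2 u)
    (hz : z ∈ (unitIdeles K ⊓ congruenceIdeles (modulusIdeal S E) : Subgroup (ideleGroup K))) :
    z' ∈ (unitIdeles K ⊓ congruenceIdeles (modulusIdeal S E) : Subgroup (ideleGroup K)) := by
  refine ⟨fun u => ?_, fun u hu => ?_, fun w hw => ?_⟩
  · rw [← h]; exact hz.1 u
  · rw [← h]; exact hz.2.1 u hu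
  · exact absurd hw (InfinitePlace.not_isReal_iff_isComplex.mpr (hTC.isComplex w))

variable (χ₀ : HeckeCharacter F₀) (c : K ≃ₐ[F₀] K) (h2 : Module.finrank F₀ K = 2) (hc : c ≠ 1)
  (hTC : IsTotallyComplex K)

include hTC in
/-- **The key identity for triples with `k ∈ F₀`.**  With `V = 𝕌_K ∩ W_𝔣`, `Φ ∘ BC = χ₀` on `(F₀ ⊗ ℝ)ˣ`
(`hα`) and `χ₀(b) = 1` for `b_∞ = 1`, `b_K ∈ V` (`hβ`): if `a_K · y = (k₀)_K` with `y ∈ V`, `k₀ ∈ F₀ˣ`, then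
`χ₀(a) Φ(y_∞) = 1` (`y = b_K` for `b = a⁻¹ (k₀)`, and `χ₀(b) = χ₀(b_∞) χ₀(b^∞) = Φ(y_∞) · 1`). [folklore] -/
theorem key_of_mem_range
    (Φ : (InfiniteAdeleRing K)ˣ →ₜ* ℂˣ)
    (hα : ∀ x : (InfiniteAdeleRing F₀)ˣ,
      (Φ (HeckeCharacter.infPart K (AdeleRing.ideleBaseChange F₀ K (infiniteIdeles F₀ x))) : ℂ) =
        χ₀ (infiniteIdeles F₀ x))
    (hβ : ∀ b : ideleGroup F₀, (b : AdeleRing (𝓞 F₀) F₀).1 = 1 →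
      AdeleRing.ideleBaseChange F₀ K b ∈
        (unitIdeles K ⊓ congruenceIdeles (modulusIdeal S E) : Subgroup (ideleGroup K)) → χ₀ b = 1)
    {a : ideleGroup F₀} {y : ideleGroup K} (k₀ : F₀ˣ)
    (hyV : y ∈ (unitIdeles K ⊓ congruenceIdeles (modulusIdeal S E) : Subgroup (ideleGroup K)))
    (h : AdeleRing.ideleBaseChange F₀ K a * y = AdeleRing.ideleBaseChange F₀ K (principalIdele F₀ k₀)) :
    (χ₀ a : ℂ) * Φ (HeckeCharacter.infPart K y) = 1 := by
  set BC := AdeleRing.ideleBaseChange F₀ K with hBC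
  -- `y = b_K`, `b = a⁻¹ (k₀)`
  set b : ideleGroup F₀ := a⁻¹ * principalIdele F₀ k₀ with hb
  have hyb : y = BC b := by
    rw [hb, map_mul, map_inv, ← h, inv_mul_cancel_left]
  -- decompose `b = b_∞ · b^∞`
  set binf : ideleGroup F₀ := infiniteIdeles F₀ (HeckeCharacter.infPart F₀ b) with hbinf
  set bf : ideleGroup F₀ := binf⁻¹ * b with hbf
  obtain ⟨hbf1, hbf2⟩ := HeckeCharacter.infiniteIdeles_infPart_inv_mul b
  have hb_eq : b = binf * bf := by rw [hbf, mul_inv_cancel_left]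
  -- `b^∞_K ∈ V`, hence `χ₀(b^∞) = 1`
  have hbfV : BC bf ∈ (unitIdeles K ⊓ congruenceIdeles (modulusIdeal S E) : Subgroup (ideleGroup K)) := by
    refine mem_nbhd_of_snd_eq S E hTC (z := BC b) (fun u => ?_) (hyb ▸ hyV)
    rw [hBC, AdeleRing.coe_ideleBaseChange, AdeleRing.coe_ideleBaseChange, AdeleRing.baseChange_snd,
      AdeleRing.baseChange_snd, FiniteAdeleRing.baseChange_apply, FiniteAdeleRing.baseChange_apply, hbf2]
  have hχbf : χ₀ bf = 1 := hβ bf hbf1 hbfV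
  -- `(b^∞_K)_∞ = 1`
  have hinf_bf : HeckeCharacter.infPart K (BC bf) = 1 := by
    apply Units.ext
    rw [HeckeCharacter.val_infPart, hBC, AdeleRing.coe_ideleBaseChange, AdeleRing.baseChange_fst, hbf1,
      map_one, Units.val_one]
  -- assemble
  have hΦy : (Φ (HeckeCharacter.infPart K y) : ℂ) = χ₀ binf := by
    rw [hyb, hb_eq, map_mul, map_mul, hinf_bf, mul_one, hbinf]
    exact hα _
  have hχb : χ₀ b = χ₀ binf := by rw [hb_eq, map_mul, hχbf, mul_one]
  have hχa : χ₀ b = (χ₀ a)⁻¹ := by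
    rw [hb, map_mul, map_inv, χ₀.map_principal (principalIdele_mem k₀), mul_one]
  rw [hΦy, ← hχb, hχa, Units.val_inv_eq_inv_val, mul_inv_cancel₀]
  exact Units.ne_zero _

end Fixed

end CMQuadraticExtension

end HeckeCharacter

end Literature.NumberTheory.GaloisRepresentations

end
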